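import Summits.ABC.IUTFork.Joshi.TestThetaValuesLocusDictionaryModel
import HarnessLib

/-!
# TEST (R-J rows Y-08 / Y-25): Joshi's hull-level volume dictionary `VolumeDictionary` at an ARBITRARY setting and place —
# the one-prime [J-IIp] inputs instantiated at every spec `(ℓ⋆, log|ξ|_0 = −r·log p)`, and the dictionary DECIDED there as the
# coincidence «Σ_j μ^log(ⁿ˒°𝒰_{j,v_ℚ₀}) = 0» (kernel; located, not adjudicated)

Test-side file of the abc-iut cell, block E / rescue sub-cell R-J «Joshi Y-discharge census» (rung LADDER-ABC:A2.RESCUE.J; seat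
abc-iut-E-t57, gen 5; R-J ROW PROTOCOL v1 2026-08-26T13:21:00Z, rows Y-08 `Joshi.VolumeDictionary` and Y-25 «[J-IIp] Thm. 9.2.1
one-prime volume inputs» of `plan/E/R-J/Y-CENSUS.tsv`). Sequel of abc-iut-E-t3's `Joshi/TestThetaValuesLocus.lean` (p429558:
`VolumeDictionary`, the FILLS-MODULO-Y line of record with target = Statement), `Joshi/ThetaLocusSaturation.lean` (p430929:
`RootTower`, `one_le_size_thetaLocus`), `Joshi/TestThetaLocusSaturation.lean` (p431044: `hullSum_nonneg_of_volumeDictionary`,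
`hullSum_eq_zero_of_volumeDictionary`) and `Joshi/TestThetaValuesLocusDictionaryModel.lean` (p438097: the `Q̄_p` model
`Model.prototypeDatum p` has `|Θ̃|_B = 1`; `VolumeDictionary` holds at the toy `unitSetting p`). Source on the Joshi side: K. Joshi,
arXiv:2303.01662 v3 = [J-IIp] (`paper:arxiv-2303.01662`, bib `Joshi2023ATS2Local`; Def. 8.3.1 p. 24 l. 9–19, §8.7 p. 25 l. 28 –
p. 26 l. 2, Thm. 9.2.1 p. 27 l. 3–6, §9.3 (9.3.1)–(9.3.2) p. 29 l. 7–40), UNREFEREED, rejected by the IUT author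
[Mochizuki2024JoshiReport], accepted by neither side of the dispute (D-0012). FRAMING: locates / conditionally verifies; no abc claim;
no side taken on [IUTchIII] Cor. 3.12 or on any author; typed ≠ proved ≠ endorsed; a model exhibits SATISFIABILITY of typed
hypotheses, nothing more. `S := Cor312Vol.PilotKummerIndRelated` occurs nowhere below.

## What is shown (kernel)

The earlier files decide `VolumeDictionary` only at TOY settings (`ℓ⋆ = 2`: `unitSetting`, `expSetting`, the pinned countermodel).
A genuine initial Θ-datum has an arbitrary `ℓ⋆ ≥ 2` and, at a prime `p` under a bad place, a q-pilot packet contribution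
`qLocal(j, p) = −r·log p` with `r ∈ ℚ_{>0}` INDEPENDENT of the label `j` (abc-iut-c312-7 / abc-iut-E-t4 lineage,
`qLocal_settingPrVolSharp_inr_labelIndep`). This file supplies the one-prime [J-IIp] side AT EVERY SUCH SPEC and decides the
dictionary there:

1. **The [J-IIp] inputs at every spec** (`Model.prototypeDatumOf p n ξ`, row Y-25): E-t3's HONEST `Q̄_p` model of the period-ring
   signature (`Model.periodRingDatum p`, p432971) carrying `ℓ⋆ := n + 1` and ANY `ξ ∈ 𝔪 ∖ 0` (`q_E := ξ^{2ℓ}`), with the canonical-point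
   datum of the proof of Thm. 9.2.1 and the root tower (`t := p`), hence Thm. 9.2.1 `|ξ|_0^{ℓ⋆} ≤ |Θ̃|_B` there and
   **`|Θ̃|_B = 1` EXACTLY** (`Model.size_thetaLocus_of_eq_one`: `≤ 1` Prop. 9.4.1 as typed, `≥ 1` saturation); every value
   `log|ξ|_0 = −r·log p`, `r ∈ ℚ_{>0}`, is attained (`Model.exists_xi_log_norm_eq`). So at a genuine one-prime spec Thm. 9.2.1's
   conclusion carries no information beyond `|ξ|_0 < 1` (Y-25: inputs INSTANTIATED; the bound is saturated).
2. **The dictionary decided at an arbitrary setting `P` and place `v_ℚ₀`** (row Y-08), writing `H := Σ_{j ∈ 𝔽_l^⋇} μ^log(ⁿ˒°𝒰_{j,v_ℚ₀})`: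
   * for EVERY prototype datum: `VolumeDictionary ⟹ qLocal(j, v_ℚ₀) = log|ξ|_0 < 0` at every label — so NO dictionary at a place
     with a nonnegative, or a label-dependent, q-contribution (`not_volumeDictionary_of_qLocal_nonneg`, `…_of_qLocal_ne`);
   * for every prototype datum with a root tower and `|Θ̃|_B ≤ 1` (all models of record): `VolumeDictionary ⟹ H = 0`
     (`hullSum_eq_zero_of_volumeDictionary_of_size_le_one`; E-t3's p431044 gives `H ≥ 0`, the size bound gives `H ≤ 0`);
   * conversely, at the model of item 1 with `ℓ⋆ = T.lstar` and `log‖ξ‖ = qLocal(·, v_ℚ₀)`: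
     **`VolumeDictionary ⟺ H = 0`** (`volumeDictionary_prototypeDatumAt_iff`); packaged
     **`exists_volumeDictionary_iff_hullSum_eq_zero`**: if `qLocal(j, v_ℚ₀) = −r·log p` for all `j` (`r ∈ ℚ_{>0}`), then SOME `ξ`
     gives a dictionary iff `H = 0`.
   Reading (neutral): at genuine data the hull-level dictionary Y_vol is neither derivable from OUR side nor refutable outright — it
   is EQUIVALENT to the measure-zero coincidence `H = 0` of OUR packet-hull log-volumes at the place, and FALSE at every place whose
   q-contribution vanishes (primes not under `Supp(𝔮)`) or whose hull-sum has a sign. The instance at the certificate setting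
   `Thm311.Real.settingPrVolSharp` is the sequel file. [claim: Joshi2023ATS2Local, status: disputed]
-/

noncomputable section

open Set

namespace Summit.ABC.IUTFork.Joshi

open Thm311 Cor312 Cor312Vol Literature.IUT.LogThetaLattice

/-! ## 1. The one-prime [J-IIp] inputs at every spec `(ℓ⋆, ξ)` over `Q̄_p` (row Y-25) -/

namespace Model

open PadicAlgCl

variable (p : ℕ) [hp : Fact p.Prime]

/-- Local copy: `‖p‖ = p⁻¹` in `Q̄_p`. [folklore] -/
private theorem norm_p_of : ‖(p : PadicAlgCl p)‖ = (p : ℝ)⁻¹ := by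
  rw [← map_natCast (algebraMap ℚ_[p] (PadicAlgCl p)), ← PadicAlgCl.coe_eq]
  show ‖((p : ℚ_[p]) : PadicAlgCl p)‖ = _
  rw [PadicAlgCl.norm_extends, Padic.norm_p]

/-- Local copy: `0 < ‖p‖ < 1`. [folklore] -/
private theorem norm_p_pos_lt_one_of : 0 < ‖(p : PadicAlgCl p)‖ ∧ ‖(p : PadicAlgCl p)‖ < 1 := by
  have h1 : (1 : ℝ) < p := by exact_mod_cast hp.out.one_lt
  rw [norm_p_of]
  exact ⟨inv_pos.2 (lt_trans one_pos h1), inv_lt_one_of_one_lt₀ h1⟩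

/-- **The [J-IIp] prototype datum at the spec `(ℓ⋆ := n+1, ξ)`**: E-t3's model period-ring datum over `Q̄_p` (p432971) with
`ℓ⋆ := n + 1`, `ξ` ANY nonzero element of the open unit ball and `q_E := ξ^{2ℓ}` (so `|ξ|_0 = |q_E|_0^{1/(2ℓ)}`). DATA of a model;
nothing about Joshi's or Mochizuki's mathematics. [folklore] -/
def prototypeDatumOf (n : ℕ) (ξ : PadicAlgCl p) (h0 : ξ ≠ 0) (h1 : ‖ξ‖ < 1) :
    PrototypeDatum (PadicAlgCl p) (PadicAlgCl p → PadicAlgCl p) (PadicAlgCl p) (PadicAlgCl p) (fun _ => PadicAlgCl p) Unit where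
  toPeriodRingDatum := periodRingDatum p
  lstar := n + 1
  one_le_lstar := Nat.le_add_left 1 n
  q := ξ ^ (2 * (2 * (n + 1) + 1))
  abs0_q := by
    show 0 < absOne p _ ∧ absOne p _ < 1
    rw [absOne_apply, norm_pow]
    exact ⟨pow_pos (norm_pos_iff.2 h0) _, pow_lt_one₀ (norm_nonneg _) h1 (by omega)⟩
  xi := ξ
  abs0_xi := by
    show absOne p ξ = (absOne p (ξ ^ (2 * (2 * (n + 1) + 1)))) ^ (1 / (2 * ((2 * (n + 1) + 1 : ℕ) : ℝ)))
    rw [absOne_apply, absOne_apply, norm_pow]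
    have h : (1 / (2 * ((2 * (n + 1) + 1 : ℕ) : ℝ))) = (((2 * (2 * (n + 1) + 1) : ℕ) : ℝ))⁻¹ := by
      push_cast
      ring
    rw [h, Real.pow_rpow_inv_natCast (norm_nonneg _) (by omega)]

variable (n : ℕ) (ξ : PadicAlgCl p) (h0 : ξ ≠ 0) (h1 : ‖ξ‖ < 1)

/-- `ℓ⋆ = n + 1` at the spec. [folklore] -/
theorem prototypeDatumOf_lstar : (prototypeDatumOf p n ξ h0 h1).lstar = n + 1 := rfl

/-- `log|ξ|_0 = log‖ξ‖` at the spec. [folklore] -/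
theorem log_abs0_xi_of : Real.log ((prototypeDatumOf p n ξ h0 h1).abs0 (prototypeDatumOf p n ξ h0 h1).xi) = Real.log ‖ξ‖ := by
  show Real.log (absOne p ξ) = _
  rw [absOne_apply]

/-- **The canonical-point datum of the proof of Thm. 9.2.1 at the spec**: `t := p` (`scale (pt p) = e_p = 1`), `a := p^{1/ℓ⋆²}`.
[folklore] -/
def canonicalPointOf : (prototypeDatumOf p n ξ h0 h1).CanonicalPoint where
  t := p
  t_ne_zero := by exact_mod_cast hp.out.ne_zero
  absF_t_lt_one := by show absOne p _ < 1; rw [absOne_apply]; exact (norm_p_pos_lt_one_of p).2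
  scale_pt_t := expo_p p
  a := rootP p ((n + 1) ^ 2)
  a_pow := by show rootP p ((n + 1) ^ 2) ^ ((n + 1) ^ 2) = (p : PadicAlgCl p); exact rootP_pow p (by positivity)

/-- **The root tower at the spec**: `t := p`, `t^{1/N} := rootP N`. [folklore] -/
def rootTowerOf : (prototypeDatumOf p n ξ h0 h1).RootTower where
  t := p
  t_ne_zero := by exact_mod_cast hp.out.ne_zero
  absF_t_lt_one := by show absOne p _ < 1; rw [absOne_apply]; exact (norm_p_pos_lt_one_of p).2
  scale_pt_t := expo_p p
  root := rootP p
  root_pow N hN := rootP_pow p hN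

/-- In the model the tuple sizes do not depend on `ρ` (every norm `|f|_ρ := ‖f(p)‖`). [folklore] -/
theorem tupleSize_rho_indep_of (ρ : ℝ) (z : Fin (prototypeDatumOf p n ξ h0 h1).lstar → (PadicAlgCl p → PadicAlgCl p)) :
    (prototypeDatumOf p n ξ h0 h1).tupleSize ρ z = (prototypeDatumOf p n ξ h0 h1).tupleSize 1 z := rfl

/-- `|Θ̃|_B ≤ 1` at the spec (Prop. 9.4.1 as typed, at every `ρ`). [folklore] -/
theorem size_thetaLocus_of_le_one :
    (prototypeDatumOf p n ξ h0 h1).size (prototypeDatumOf p n ξ h0 h1).thetaLocus ≤ 1 :=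
  iSup₂_le fun ρ _ => by
    show (prototypeDatumOf p n ξ h0 h1).sizeAt _ ρ ≤ 1
    have : (prototypeDatumOf p n ξ h0 h1).sizeAt (prototypeDatumOf p n ξ h0 h1).thetaLocus ρ =
        (prototypeDatumOf p n ξ h0 h1).sizeAt (prototypeDatumOf p n ξ h0 h1).thetaLocus 1 := rfl
    rw [this]
    exact (prototypeDatumOf p n ξ h0 h1).sizeAt_one_thetaLocus_le_one

/-- **`|Θ̃|_B = 1` EXACTLY at every spec** (`≤ 1` Prop. 9.4.1, `≥ 1` saturation along the root tower, p430929). So Thm. 9.2.1's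
conclusion `|ξ|_0^{ℓ⋆} ≤ |Θ̃|_B` is saturated at every one-prime spec. [claim: Joshi2023ATS2Local, status: disputed] -/
theorem size_thetaLocus_of_eq_one :
    (prototypeDatumOf p n ξ h0 h1).size (prototypeDatumOf p n ξ h0 h1).thetaLocus = 1 :=
  le_antisymm (size_thetaLocus_of_le_one p n ξ h0 h1) (rootTowerOf p n ξ h0 h1).one_le_size_thetaLocus

/-- Thm. 9.2.1 (`prototypeBound`) HOLDS at the spec, through the canonical point — and trivially, `|Θ̃|_B` being `1`.
[claim: Joshi2023ATS2Local, status: disputed] -/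
theorem prototypeBound_of :
    ((((prototypeDatumOf p n ξ h0 h1).abs0 (prototypeDatumOf p n ξ h0 h1).xi) ^ (prototypeDatumOf p n ξ h0 h1).lstar : ℝ) :
        EReal) ≤ (prototypeDatumOf p n ξ h0 h1).size (prototypeDatumOf p n ξ h0 h1).thetaLocus :=
  (prototypeDatumOf p n ξ h0 h1).prototypeBound (canonicalPointOf p n ξ h0 h1)

/-- **Every value `log|ξ|_0 = −r·log p`, `r ∈ ℚ_{>0}`, is attained** by a nonzero `ξ` of the open unit ball of `Q̄_p` (elements of
every rational norm exponent, E-t3's `Model.exists_norm_eq_rpow`). [folklore] -/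
theorem exists_xi_log_norm_eq (r : ℚ) (hr : 0 < r) :
    ∃ ξ : PadicAlgCl p, ξ ≠ 0 ∧ ‖ξ‖ < 1 ∧ Real.log ‖ξ‖ = -((r : ℝ) * Real.log p) := by
  obtain ⟨c, hc0, hc⟩ := exists_norm_eq_rpow p (-r)
  have hp1 : (1 : ℝ) < p := by exact_mod_cast hp.out.one_lt
  refine ⟨c, hc0, ?_, ?_⟩
  · rw [hc]
    push_cast
    exact Real.rpow_lt_one_of_one_lt_of_neg hp1 (neg_neg_of_pos (by exact_mod_cast hr))
  · rw [hc, Real.log_rpow (lt_trans one_pos hp1)]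
    push_cast
    ring

/-- **Row Y-25, packaged — the one-prime inputs of [J-IIp] Thm. 9.2.1 are INSTANTIATED at every genuine spec**: for every prime `p`,
every `ℓ⋆ = n + 1 ≥ 1` and every `r ∈ ℚ_{>0}` there is a prototype datum over `Q̄_p` with `ℓ⋆ = n + 1`, `log|ξ|_0 = −r·log p`, a
canonical point, a root tower, Thm. 9.2.1's bound and `|Θ̃|_B = 1`. A satisfiability witness; nothing about which spec the intended
situation produces. [claim: Joshi2023ATS2Local, status: disputed] -/
theorem thm921_inputs_at_spec (r : ℚ) (hr : 0 < r) :
    ∃ J : PrototypeDatum (PadicAlgCl p) (PadicAlgCl p → PadicAlgCl p) (PadicAlgCl p) (PadicAlgCl p) (fun _ => PadicAlgCl p) Unit,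
      J.lstar = n + 1 ∧ Real.log (J.abs0 J.xi) = -((r : ℝ) * Real.log p) ∧ Nonempty J.CanonicalPoint ∧ Nonempty J.RootTower ∧
        (((J.abs0 J.xi) ^ J.lstar : ℝ) : EReal) ≤ J.size J.thetaLocus ∧ J.size J.thetaLocus = 1 := by
  obtain ⟨ξ, h0, h1, hξ⟩ := exists_xi_log_norm_eq p r hr
  exact ⟨prototypeDatumOf p n ξ h0 h1, rfl, by rw [log_abs0_xi_of, hξ], ⟨canonicalPointOf p n ξ h0 h1⟩,
    ⟨rootTowerOf p n ξ h0 h1⟩, prototypeBound_of p n ξ h0 h1, size_thetaLocus_of_eq_one p n ξ h0 h1⟩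

end Model

/-! ## 2. The dictionary at an ARBITRARY setting and place (row Y-08) -/

section AnyDatum

variable {F B E0 : Type} [Field F] [CommRing B] [Field E0] {Y : Type} {K : Y → Type} [∀ y, Field (K y)] {G : Type}
  {J : PrototypeDatum F B E0 Y K G} {T : ThetaIndex} {S : Situation T} {P : Cor312.Setting S} {vQ₀ : T.VQ}

/-- **(ii) pins the q-side, for EVERY prototype datum**: a volume dictionary at `v_ℚ₀` forces the q-pilot packet contribution there to
be the NEGATIVE constant `log|ξ|_0` at every label of `𝔽_l^⋇`. [claim: Joshi2023ATS2Local, status: disputed] -/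
theorem qLocal_neg_of_volumeDictionary (D : VolumeDictionary J P vQ₀) (i : Fin T.lstar) :
    P.qLocal (Setting.labelSucc i) vQ₀ < 0 := by
  rw [D.qLocal_eq i]
  exact Real.log_neg J.abs0_xi_pos J.abs0_xi_lt_one

/-- Hence NO volume dictionary — for any prototype datum whatsoever — at a place where some q-pilot packet contribution is `≥ 0`
(e.g. a prime NOT under `Supp(𝔮)`, where `qLocal = 0`). [claim: Joshi2023ATS2Local, status: disputed] -/
theorem not_volumeDictionary_of_qLocal_nonneg (i : Fin T.lstar) (h : 0 ≤ P.qLocal (Setting.labelSucc i) vQ₀) :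
    ¬ VolumeDictionary J P vQ₀ := fun D => (not_lt.2 h) (qLocal_neg_of_volumeDictionary D i)

/-- … and NO volume dictionary at a place where the q-pilot packet contribution DEPENDS on the label. [claim: Joshi2023ATS2Local, status: disputed] -/
theorem not_volumeDictionary_of_qLocal_ne (i i' : Fin T.lstar)
    (h : P.qLocal (Setting.labelSucc i) vQ₀ ≠ P.qLocal (Setting.labelSucc i') vQ₀) : ¬ VolumeDictionary J P vQ₀ := fun D =>
  h (by rw [D.qLocal_eq i, D.qLocal_eq i'])

/-- **(iii) under `|Θ̃|_B ≤ 1` bounds the hull-sum above**: a volume dictionary at `v_ℚ₀` from a prototype datum with `|Θ̃|_B ≤ 1`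
(Prop. 9.4.1 extended to all `ρ`; every model of record) forces `Σ_j μ^log(ⁿ˒°𝒰_{j,v_ℚ₀}) ≤ 0`. [claim: Joshi2023ATS2Local, status: disputed] -/
theorem hullSum_nonpos_of_volumeDictionary_of_size_le_one (D : VolumeDictionary J P vQ₀) (hJ : J.size J.thetaLocus ≤ 1) :
    ∑ i : Fin T.lstar, (S.D P.n).logvol (Setting.labelSucc i) vQ₀ (P.thetaHull (Setting.labelSucc i) vQ₀) ≤ 0 := by
  rw [D.size_eq, ← EReal.coe_one, EReal.coe_le_coe_iff] at hJ
  exact Real.exp_le_one_iff.1 hJ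

/-- **The dictionary pins the hull-sum to `0`** for every prototype datum with a root tower and `|Θ̃|_B ≤ 1`: `≥ 0` by E-t3's
saturation (p431044 `hullSum_nonneg_of_volumeDictionary`), `≤ 0` by the size bound. [claim: Joshi2023ATS2Local, status: disputed] -/
theorem hullSum_eq_zero_of_volumeDictionary_of_size_le_one (D : VolumeDictionary J P vQ₀) (r : J.RootTower)
    (hJ : J.size J.thetaLocus ≤ 1) :
    ∑ i : Fin T.lstar, (S.D P.n).logvol (Setting.labelSucc i) vQ₀ (P.thetaHull (Setting.labelSucc i) vQ₀) = 0 :=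
  hullSum_eq_zero_of_volumeDictionary D r (hullSum_nonpos_of_volumeDictionary_of_size_le_one D hJ)

/-- Hence NO volume dictionary from such a datum at a place whose hull-sum is NONZERO (either sign). [claim: Joshi2023ATS2Local, status: disputed] -/
theorem not_volumeDictionary_of_hullSum_ne_zero (r : J.RootTower) (hJ : J.size J.thetaLocus ≤ 1)
    (h : ∑ i : Fin T.lstar, (S.D P.n).logvol (Setting.labelSucc i) vQ₀ (P.thetaHull (Setting.labelSucc i) vQ₀) ≠ 0) :
    ¬ VolumeDictionary J P vQ₀ := fun D => h (hullSum_eq_zero_of_volumeDictionary_of_size_le_one D r hJ)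

/-- … in particular at a place whose hull-sum is POSITIVE (the negative case is E-t3's `not_volumeDictionary_of_hullSum_neg`, root
tower alone). [claim: Joshi2023ATS2Local, status: disputed] -/
theorem not_volumeDictionary_of_hullSum_pos (r : J.RootTower) (hJ : J.size J.thetaLocus ≤ 1)
    (h : 0 < ∑ i : Fin T.lstar, (S.D P.n).logvol (Setting.labelSucc i) vQ₀ (P.thetaHull (Setting.labelSucc i) vQ₀)) :
    ¬ VolumeDictionary J P vQ₀ :=
  not_volumeDictionary_of_hullSum_ne_zero r hJ h.ne'

/-- **What a dictionary from such a datum SAYS about OUR side, in full**: `qLocal(j, v_ℚ₀) = log|ξ|_0 < 0` at every label, `ℓ⋆`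
agrees, and the hull-sum at `v_ℚ₀` vanishes. [claim: Joshi2023ATS2Local, status: disputed] -/
theorem volumeDictionary_readout (D : VolumeDictionary J P vQ₀) (r : J.RootTower) (hJ : J.size J.thetaLocus ≤ 1) :
    T.lstar = J.lstar ∧ (∀ i : Fin T.lstar, P.qLocal (Setting.labelSucc i) vQ₀ = Real.log (J.abs0 J.xi)) ∧
      (∀ i : Fin T.lstar, P.qLocal (Setting.labelSucc i) vQ₀ < 0) ∧
        ∑ i : Fin T.lstar, (S.D P.n).logvol (Setting.labelSucc i) vQ₀ (P.thetaHull (Setting.labelSucc i) vQ₀) = 0 :=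
  ⟨D.lstar_eq, D.qLocal_eq, qLocal_neg_of_volumeDictionary D, hullSum_eq_zero_of_volumeDictionary_of_size_le_one D r hJ⟩

end AnyDatum

/-! ## 3. The converse at the model: `VolumeDictionary ⟺ hull-sum = 0` -/

section ModelAt

variable (p : ℕ) [hp : Fact p.Prime] {T : ThetaIndex} {S : Situation T} (P : Cor312.Setting S) (vQ₀ : T.VQ)
  (ξ : PadicAlgCl p) (h0 : ξ ≠ 0) (h1 : ‖ξ‖ < 1)

/-- The model datum AT the index of a setting: spec `ℓ⋆ := T.lstar` (as `(T.lstar − 1) + 1`), `ξ` given. [folklore] -/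
def Model.prototypeDatumAt (T : ThetaIndex) (ξ : PadicAlgCl p) (h0 : ξ ≠ 0) (h1 : ‖ξ‖ < 1) :
    PrototypeDatum (PadicAlgCl p) (PadicAlgCl p → PadicAlgCl p) (PadicAlgCl p) (PadicAlgCl p) (fun _ => PadicAlgCl p) Unit :=
  Model.prototypeDatumOf p (T.lstar - 1) ξ h0 h1

/-- `ℓ⋆` agrees: `T.lstar = (T.lstar − 1) + 1` (`ℓ⋆ ≥ 2`). [folklore] -/
theorem Model.lstar_eq_prototypeDatumAt : T.lstar = (Model.prototypeDatumAt p T ξ h0 h1).lstar := by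
  show T.lstar = T.lstar - 1 + 1
  have := T.two_le_lstar
  omega

/-- **`VolumeDictionary ⟺ hull-sum = 0` at the model datum**, whenever the q-pilot packet contribution at `v_ℚ₀` is the constant
`log‖ξ‖` at every label: (i) holds by construction, (ii) is the hypothesis, (iii) reads `1 = exp H`. [claim: Joshi2023ATS2Local, status: disputed] -/
theorem volumeDictionary_prototypeDatumAt_iff (hq : ∀ i : Fin T.lstar, P.qLocal (Setting.labelSucc i) vQ₀ = Real.log ‖ξ‖) :
    VolumeDictionary (Model.prototypeDatumAt p T ξ h0 h1) P vQ₀ ↔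
      ∑ i : Fin T.lstar, (S.D P.n).logvol (Setting.labelSucc i) vQ₀ (P.thetaHull (Setting.labelSucc i) vQ₀) = 0 := by
  constructor
  · intro D
    exact hullSum_eq_zero_of_volumeDictionary_of_size_le_one D (Model.rootTowerOf p _ ξ h0 h1)
      (Model.size_thetaLocus_of_le_one p _ ξ h0 h1)
  · intro hH
    refine ⟨Model.lstar_eq_prototypeDatumAt p ξ h0 h1, fun i => ?_, ?_⟩
    · rw [hq i]
      exact (Model.log_abs0_xi_of p _ ξ h0 h1).symm
    · rw [hH, Real.exp_zero, EReal.coe_one]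
      exact Model.size_thetaLocus_of_eq_one p _ ξ h0 h1

/-- The model dictionary HOLDS at a place with constant q-contribution `log‖ξ‖` and vanishing hull-sum. [claim: Joshi2023ATS2Local, status: disputed] -/
theorem volumeDictionary_prototypeDatumAt_of_hullSum_eq_zero
    (hq : ∀ i : Fin T.lstar, P.qLocal (Setting.labelSucc i) vQ₀ = Real.log ‖ξ‖)
    (hH : ∑ i : Fin T.lstar, (S.D P.n).logvol (Setting.labelSucc i) vQ₀ (P.thetaHull (Setting.labelSucc i) vQ₀) = 0) :
    VolumeDictionary (Model.prototypeDatumAt p T ξ h0 h1) P vQ₀ :=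
  (volumeDictionary_prototypeDatumAt_iff p P vQ₀ ξ h0 h1 hq).2 hH

/-- **Row Y-08 at an arbitrary setting, packaged**: if the q-pilot packet contribution at `v_ℚ₀` is `−r·log p` at every label of
`𝔽_l^⋇` (`r ∈ ℚ_{>0}` — the shape at a prime under `Supp(𝔮)` of a genuine initial Θ-datum), then SOME nonzero `ξ` of the open unit ball
of `Q̄_p` gives a volume dictionary from the model datum iff the hull-sum at `v_ℚ₀` VANISHES. The dictionary is decided on OUR side as
this coincidence; it is not derived from, nor refuted by, anything else. [claim: Joshi2023ATS2Local, status: disputed] -/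
theorem exists_volumeDictionary_iff_hullSum_eq_zero {r : ℚ} (hr : 0 < r)
    (hq : ∀ i : Fin T.lstar, P.qLocal (Setting.labelSucc i) vQ₀ = -((r : ℝ) * Real.log p)) :
    (∃ (ξ : PadicAlgCl p) (h0 : ξ ≠ 0) (h1 : ‖ξ‖ < 1), VolumeDictionary (Model.prototypeDatumAt p T ξ h0 h1) P vQ₀) ↔
      ∑ i : Fin T.lstar, (S.D P.n).logvol (Setting.labelSucc i) vQ₀ (P.thetaHull (Setting.labelSucc i) vQ₀) = 0 := by
  constructor
  · rintro ⟨ξ, h0, h1, D⟩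
    exact hullSum_eq_zero_of_volumeDictionary_of_size_le_one D (Model.rootTowerOf p _ ξ h0 h1)
      (Model.size_thetaLocus_of_le_one p _ ξ h0 h1)
  · intro hH
    obtain ⟨ξ, h0, h1, hξ⟩ := Model.exists_xi_log_norm_eq p r hr
    exact ⟨ξ, h0, h1, volumeDictionary_prototypeDatumAt_of_hullSum_eq_zero p P vQ₀ ξ h0 h1 (fun i => by rw [hq i, hξ]) hH⟩

/-- **… and then the FILLS-MODULO-Y line's local conclusion is EXACTLY as strong as its input**: at such a place the model dictionary
yields `Σ_j qLocal ≤ Σ_j μ^log(ⁿ˒°𝒰_j)` (p429558 `labelSum_qLocal_le_of_volumeDictionary`) — whose right-hand side the dictionary itself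
has pinned to `0` and whose left-hand side is `−ℓ⋆·r·log p < 0`. [claim: Joshi2023ATS2Local, status: disputed] -/
theorem labelSum_qLocal_le_of_volumeDictionary_prototypeDatumAt
    (D : VolumeDictionary (Model.prototypeDatumAt p T ξ h0 h1) P vQ₀) :
    ∑ i : Fin T.lstar, P.qLocal (Setting.labelSucc i) vQ₀ ≤
        ∑ i : Fin T.lstar, (S.D P.n).logvol (Setting.labelSucc i) vQ₀ (P.thetaHull (Setting.labelSucc i) vQ₀) ∧
      ∑ i : Fin T.lstar, (S.D P.n).logvol (Setting.labelSucc i) vQ₀ (P.thetaHull (Setting.labelSucc i) vQ₀) = 0 :=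
  ⟨labelSum_qLocal_le_of_volumeDictionary D (Model.canonicalPointOf p _ ξ h0 h1),
    hullSum_eq_zero_of_volumeDictionary_of_size_le_one D (Model.rootTowerOf p _ ξ h0 h1)
      (Model.size_thetaLocus_of_le_one p _ ξ h0 h1)⟩

end ModelAt

/-! ## 4. The toy settings of record re-read through the general criterion -/

section Toys

variable (p : ℕ) [hp : Fact p.Prime]

open Cor312Vol.NaiveWitness Cor312.Checks

/-- Consistency check at E-t3's `unitSetting p` (hull-sum `0`, `qLocal = −log p`): the general criterion re-derives p438097's
`volumeDictionary_unitSetting`, now for the spec datum `prototypeDatumAt p toyIndex p`. [folklore] -/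
theorem volumeDictionary_prototypeDatumAt_unitSetting (vQ : toyIndex.VQ) :
    VolumeDictionary (Model.prototypeDatumAt p toyIndex (p : PadicAlgCl p) (by exact_mod_cast hp.out.ne_zero)
      (by
        have h1 : (1 : ℝ) < p := by exact_mod_cast hp.out.one_lt
        rw [← map_natCast (algebraMap ℚ_[p] (PadicAlgCl p)), ← PadicAlgCl.coe_eq]
        show ‖((p : ℚ_[p]) : PadicAlgCl p)‖ < 1
        rw [PadicAlgCl.norm_extends, Padic.norm_p]
        exact inv_lt_one_of_one_lt₀ h1)) (unitSetting p) vQ :=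
  volumeDictionary_prototypeDatumAt_of_hullSum_eq_zero p (unitSetting p) vQ _ _ _
    (fun i => by rw [unit_qLocal_labelSucc, Model.log_norm_p]) (Finset.sum_eq_zero fun i _ => unit_hullLogvol p _ vQ)

/-- Consistency check at abc-iut-w5-d232's census `expSetting p e` (hull-sum `−5·log p < 0`, p432781): NO dictionary from ANY spec datum,
by the general criterion (E-t3's `not_volumeDictionary_expSetting` re-derived). [folklore] -/
theorem not_volumeDictionary_prototypeDatumAt_expSetting (e : toyIndex.LabelStar → ℕ) (vQ : toyIndex.VQ) (ξ : PadicAlgCl p)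
    (h0 : ξ ≠ 0) (h1 : ‖ξ‖ < 1) : ¬ VolumeDictionary (Model.prototypeDatumAt p toyIndex ξ h0 h1) (expSetting p e) vQ :=
  not_volumeDictionary_of_hullSum_ne_zero (Model.rootTowerOf p _ ξ h0 h1) (Model.size_thetaLocus_of_le_one p _ ξ h0 h1)
    (expSetting_hullSum_neg p e vQ).ne

end Toys

end Summit.ABC.IUTFork.Joshi

end
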